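import Summits.ValiantsHypothesis.ValiantsHypothesis.Theorems.KPlusLogSqLawTropicalBConvexPosition

/-!
# Route «KPlusLogSqLaw», crux `TropicalB` (stmt-ValiantsHypothesis-19771) — CONVEX POSITION OF THE DOMINANT SET, part 3:
# strict convexity and the arc law

HONEST FRAMING.  Helper file of the object-search cell `pub-symmetroid` (seat val-sym-trop-p2 g3) for the crux
`Summit.ValiantsHypothesis.ValiantsHypothesis.Theses.KPlusLogSqLaw.TropicalB` (ledger item `stmt-ValiantsHypothesis-19771`, route
`KPlusLogSqLaw`; registered stubs `stub_tropThin` / `stub_tropFat` of `Cruxes/TropicalB/Lines/birth.lean`, each ⟺ the crux), landed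
`--supports`; it does NOT close the item and asserts nothing about `TropicalB` in its window, `WeakLifting`, `KPlusLogSqLaw`,
`MatrixDescartes` (stmt-ValiantsHypothesis-18050) or `VP ≠ VNP`.  Structural facts about chains of unique optima (`IsDominant`) of an
ARBITRARY dominance design `(d, v, ε)` of an arbitrary format `(m, K)` at strictly increasing integer slopes, consecutive terms distinct:
no support class, no exponent regime, no sign condition.

RESULTS (continuing parts 1–2, `…TropicalBConvexPositionDefs` / `…TropicalBConvexPosition`; Newton-polygon coordinates
`IntervalOpt.sl d univ` / `IntervalOpt.cst v univ` of `…TropicalBNewtonPolygon`).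
* `ConvexPosition.below_chord` — STRICT CONVEXITY, cleared denominators: a dominant term `q` lies strictly below the chord of any two
  present terms `p ≠ q ≠ r` whose slopes bracket its slope,
  `(sl r − sl p)·cst q < (sl r − sl q)·cst p + (sl q − sl p)·cst r`; only the dominance of the MIDDLE term is used.  Chain forms:
  `chain_slope_lt` (slopes strictly increase, from the tree's `TropicalCensus.slope_lt_of_dominant`), `chain_ne`, `chain_below_chord`.
* `ConvexPosition.arc_law` — **ARC LAW**: let `μ` be natural weights, not all zero, supported on an arc `a ≤ k ≤ b` of the chain and `ν`
  natural weights supported on chain indices outside the arc, with the same total weight (automatic for `m > 0`, part 1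
  `weight_eq_of_rel`).  Then `Σ μ_k · inc (p k) ≠ Σ ν_k · inc (p k)`: no conic combination of an arc equals a conic combination of the rest
  of the chain — a linear relation among dominant terms never has sign pattern `+ − +` or `+ −` in slope order.  Proof: the chord functional
  `Φ = (B − A)·cst − (β − α)·sl + const` of the two neighbours `p (a−1)`, `p (b+1)` of the arc is a linear evaluation plus a constant, negative
  on the arc, zero at the neighbours and positive beyond them (`chain_below_chord` three times); an arc touching an end of the chain is
  separated by the slope functional instead.
* `ConvexPosition.not_conic_of_others` — the one-point arc: a chain term is never a rational convex combination of the other chain terms.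

RELATION TO THE TREE.  As for part 2: the arc law is the dominant-set-internal, non-existence form of val-sym-lift-p1 g3's majorization
law `TropicalCensus.sum_mul_slope_lt_of_redecomp` (`…TropicalExchange`: the θ-weighted slope of ANY re-decomposition of a dominant family
is strictly smaller; outside-the-arc terms are more spread in slope than the arc, so rearrangement gives the contradiction); the proof
here is the direct convexity argument and imports neither.  For a fixed design ALL terms dominant at integer slopes, sorted by slope, form
such a chain, so the law constrains the whole dominant set.  [folklore: an arc of a convex polygon is separated from the other vertices by
the chord of its neighbours; the packaging for dominance designs is the cell's]
-/

-- `Summit.ValiantsHypothesis.ValiantsHypothesis.…` repeats a component by the D-0017 layout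
-- (single-conjunct summit), which the `dupNamespace` linter flags; the name is mandated.
set_option linter.dupNamespace false
set_option autoImplicit false

namespace Summit.ValiantsHypothesis.ValiantsHypothesis.Theorems.KPlusLogSqLaw

open Summit.ValiantsHypothesis.ValiantsHypothesis.Theorems.MatrixDescartes.Negative
open Summit.ValiantsHypothesis.ValiantsHypothesis.Theorems.LacunarySymmetroidMatrixDescartes
open scoped BigOperators
open Finset

namespace ConvexPosition

variable {m K : ℕ}

/-! ## Strict convexity and the arc law along a dominant chain -/

section Arc

variable (d : Fin K → ℕ) (v ε : Fin m → Fin m → Fin K → ℤ)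

/-- **Below the chord.**  A dominant term `q` lies strictly below the chord of any two present terms `p ≠ q ≠ r` whose slopes
bracket its slope: `(slope r − slope p)·val q < (slope r − slope q)·val p + (slope q − slope p)·val r`.  Only the dominance of the
MIDDLE term is used. [folklore: strict convexity of the Newton polygon] -/
theorem below_chord {θ : ℤ} {p q r : Equiv.Perm (Fin m) × (Fin m → Fin K)} (hq : IsDominant d v ε θ q)
    (hp : termSign ε p ≠ 0) (hr : termSign ε r ≠ 0) (hpq : p ≠ q) (hrq : r ≠ q)
    (h1 : IntervalOpt.sl d univ p < IntervalOpt.sl d univ q) (h2 : IntervalOpt.sl d univ q < IntervalOpt.sl d univ r) :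
    (IntervalOpt.sl d univ r - IntervalOpt.sl d univ p) * IntervalOpt.cst v univ q < (IntervalOpt.sl d univ r - IntervalOpt.sl d univ q) * IntervalOpt.cst v univ p + (IntervalOpt.sl d univ q - IntervalOpt.sl d univ p) * IntervalOpt.cst v univ r := by
  have a1 := hq.2 p hpq hp
  have a2 := hq.2 r hrq hr
  rw [NewtonPolygon.tropWeight_eq_sl_sub_cst d v, NewtonPolygon.tropWeight_eq_sl_sub_cst d v] at a1 a2
  nlinarith [mul_lt_mul_of_pos_left a1 (sub_pos.mpr h2), mul_lt_mul_of_pos_left a2 (sub_pos.mpr h1)]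

variable {n : ℕ} (θ : ℕ → ℤ) (p : ℕ → Equiv.Perm (Fin m) × (Fin m → Fin K))

/-- slopes increase at every step of a dominant chain with distinct consecutive terms. [tree: `TropicalCensus.slope_lt_of_dominant`, `IntervalOpt.sl d univ = slope d` by `rfl`] -/
theorem chain_slope_lt_succ (hdom : ∀ k ≤ n, IsDominant d v ε (θ k) (p k)) (hθ : ∀ k < n, θ k < θ (k + 1))
    (hne : ∀ k < n, p k ≠ p (k + 1)) {k : ℕ} (hk : k < n) : IntervalOpt.sl d univ (p k) < IntervalOpt.sl d univ (p (k + 1)) :=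
  TropicalCensus.slope_lt_of_dominant d v ε (hθ k hk) (hne k hk) (hdom k hk.le) (hdom (k + 1) hk)

/-- slopes strictly increase along the chain. -/
theorem chain_slope_lt (hdom : ∀ k ≤ n, IsDominant d v ε (θ k) (p k)) (hθ : ∀ k < n, θ k < θ (k + 1))
    (hne : ∀ k < n, p k ≠ p (k + 1)) {j k : ℕ} (hjk : j < k) (hk : k ≤ n) : IntervalOpt.sl d univ (p j) < IntervalOpt.sl d univ (p k) := by
  induction k with
  | zero => exact absurd hjk (Nat.not_lt_zero _)
  | succ k ih =>
    have hstep := chain_slope_lt_succ d v ε θ p hdom hθ hne (k := k) hk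
    rcases Nat.lt_succ_iff_lt_or_eq.mp hjk with h | h
    · exact (ih h (Nat.le_of_succ_le hk)).trans hstep
    · subst h; exact hstep

/-- terms of the chain are pairwise distinct. -/
theorem chain_ne (hdom : ∀ k ≤ n, IsDominant d v ε (θ k) (p k)) (hθ : ∀ k < n, θ k < θ (k + 1))
    (hne : ∀ k < n, p k ≠ p (k + 1)) {j k : ℕ} (hjk : j < k) (hk : k ≤ n) : p j ≠ p k := by
  intro h
  have := chain_slope_lt d v ε θ p hdom hθ hne hjk hk
  rw [h] at this
  exact lt_irrefl _ this

/-- **the chain is strictly convex**: for `i < j < k` the `j`-th point lies strictly below the chord from the `i`-th to the `k`-th. -/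
theorem chain_below_chord (hdom : ∀ k ≤ n, IsDominant d v ε (θ k) (p k)) (hθ : ∀ k < n, θ k < θ (k + 1))
    (hne : ∀ k < n, p k ≠ p (k + 1)) {i j k : ℕ} (hij : i < j) (hjk : j < k) (hk : k ≤ n) :
    (IntervalOpt.sl d univ (p k) - IntervalOpt.sl d univ (p i)) * IntervalOpt.cst v univ (p j) <
      (IntervalOpt.sl d univ (p k) - IntervalOpt.sl d univ (p j)) * IntervalOpt.cst v univ (p i) + (IntervalOpt.sl d univ (p j) - IntervalOpt.sl d univ (p i)) * IntervalOpt.cst v univ (p k) :=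
  below_chord d v ε (hdom j (hjk.le.trans hk)) (hdom i ((hij.trans hjk).le.trans hk)).1 (hdom k hk).1
    (chain_ne d v ε θ p hdom hθ hne hij (hjk.le.trans hk)) (chain_ne d v ε θ p hdom hθ hne hjk hk).symm
    (chain_slope_lt d v ε θ p hdom hθ hne hij (hjk.le.trans hk)) (chain_slope_lt d v ε θ p hdom hθ hne hjk hk)

/-- weighted sums of an affine function of (slope, valuation). [folklore] -/
theorem sum_affine (s : Finset ℕ) (w S V : ℕ → ℤ) (c₁ c₂ c₃ : ℤ) :
    ∑ k ∈ s, w k * (c₁ * V k + c₂ * S k + c₃) =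
      c₁ * ∑ k ∈ s, w k * V k + c₂ * ∑ k ∈ s, w k * S k + c₃ * ∑ k ∈ s, w k := by
  simp only [Finset.mul_sum, ← Finset.sum_add_distrib]
  exact Finset.sum_congr rfl fun k _ => by ring

/-- **ARC LAW.**  Along a dominant chain `p 0, …, p n` (integer slopes `θ 0 < ⋯ < θ n`, consecutive terms distinct) let `μ` be natural
weights supported on an arc `a ≤ k ≤ b` (`b ≤ n`), not all zero, and `ν` natural weights supported on chain indices outside the arc, with
the same total weight.  Then `Σ μ_k · inc (p k) ≠ Σ ν_k · inc (p k)`: no conic combination of an arc equals a conic combination of the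
rest of the chain.  (A linear relation among dominant terms never has sign pattern `+ − +` or `+ −` in slope order.) [folklore: an arc
of a convex polygon is separated from the other vertices by the chord of its neighbours] -/
theorem arc_law (hdom : ∀ k ≤ n, IsDominant d v ε (θ k) (p k)) (hθ : ∀ k < n, θ k < θ (k + 1))
    (hne : ∀ k < n, p k ≠ p (k + 1)) {a b : ℕ} (hab : a ≤ b) (hbn : b ≤ n) (μ ν : ℕ → ℕ)
    (hμ : ∀ k, μ k ≠ 0 → a ≤ k ∧ k ≤ b) (hν : ∀ k, ν k ≠ 0 → (k < a ∨ b < k) ∧ k ≤ n) (hμ0 : ∃ k, μ k ≠ 0)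
    (hMN : ∑ k ∈ range (n + 1), μ k = ∑ k ∈ range (n + 1), ν k)
    (hrel : ∑ k ∈ range (n + 1), μ k • inc (p k) = ∑ k ∈ range (n + 1), ν k • inc (p k)) : False := by
  classical
  -- notation
  set S : ℕ → ℤ := fun k => IntervalOpt.sl d univ (p k) with hS
  set V : ℕ → ℤ := fun k => IntervalOpt.cst v univ (p k) with hV
  -- the two linear identities and the weight identity, as integers
  have E1 : ∑ k ∈ range (n + 1), (μ k : ℤ) * S k = ∑ k ∈ range (n + 1), (ν k : ℤ) * S k := by
    have := ev_rel (range (n + 1)) μ ν p hrel fun x => (d x.2.2 : ℤ)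
    simpa only [ev_d_eq_sl] using this
  have E2 : ∑ k ∈ range (n + 1), (μ k : ℤ) * V k = ∑ k ∈ range (n + 1), (ν k : ℤ) * V k := by
    have := ev_rel (range (n + 1)) μ ν p hrel fun x => v x.1 x.2.1 x.2.2
    simpa only [ev_v_eq_cst] using this
  have E0 : ∑ k ∈ range (n + 1), (μ k : ℤ) = ∑ k ∈ range (n + 1), (ν k : ℤ) := by exact_mod_cast hMN
  -- the arc index carrying weight
  obtain ⟨k₀, hk₀⟩ := hμ0
  have hk₀ab := hμ k₀ hk₀
  have hk₀r : k₀ ∈ range (n + 1) := mem_range.mpr (by omega)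
  have hMpos : 0 < ∑ k ∈ range (n + 1), (μ k : ℤ) := by
    have : (μ k₀ : ℤ) ≤ ∑ k ∈ range (n + 1), (μ k : ℤ) :=
      Finset.single_le_sum (f := fun k => (μ k : ℤ)) (fun k _ => by positivity) hk₀r
    have : (0 : ℤ) < μ k₀ := by exact_mod_cast Nat.pos_of_ne_zero hk₀
    omega
  have slt : ∀ {j k : ℕ}, j < k → k ≤ n → S j < S k := fun hjk hk => chain_slope_lt d v ε θ p hdom hθ hne hjk hk
  have sle : ∀ {j k : ℕ}, j ≤ k → k ≤ n → S j ≤ S k := by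
    intro j k hjk hk
    rcases hjk.lt_or_eq with h | h
    · exact (slt h hk).le
    · rw [h]
  -- case split on whether the arc touches the ends of the chain
  by_cases ha0 : a = 0
  · -- arc = prefix: `ν` lives on `k > b`; compare weighted slope sums
    subst ha0
    have hL : ∑ k ∈ range (n + 1), (μ k : ℤ) * S k ≤ (∑ k ∈ range (n + 1), (μ k : ℤ)) * S b := by
      rw [Finset.sum_mul]
      apply Finset.sum_le_sum
      intro k _
      by_cases hk : μ k = 0
      · simp [hk]
      · exact mul_le_mul_of_nonneg_left (sle (hμ k hk).2 hbn) (by positivity)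
    have hR : (∑ k ∈ range (n + 1), (ν k : ℤ)) * S b ≤ ∑ k ∈ range (n + 1), (ν k : ℤ) * S k := by
      rw [Finset.sum_mul]
      apply Finset.sum_le_sum
      intro k _
      by_cases hk : ν k = 0
      · simp [hk]
      · have hkk := hν k hk
        have hbk : b < k := by omega
        exact mul_le_mul_of_nonneg_left (sle hbk.le hkk.2) (by positivity)
    -- some `ν` weight sits strictly above `b`, where the slope is strictly larger
    have hR' : (∑ k ∈ range (n + 1), (ν k : ℤ)) * S b < ∑ k ∈ range (n + 1), (ν k : ℤ) * S k := by
      rw [Finset.sum_mul]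
      apply Finset.sum_lt_sum
      · intro k _
        by_cases hk : ν k = 0
        · simp [hk]
        · have hkk := hν k hk
          have hbk : b < k := by omega
          exact mul_le_mul_of_nonneg_left (sle hbk.le hkk.2) (by positivity)
      · -- a `ν`-index exists since the total `ν` weight is positive
        have hNpos : ∑ k ∈ range (n + 1), (0 : ℤ) < ∑ k ∈ range (n + 1), (ν k : ℤ) := by
          rw [← E0]; simpa using hMpos
        obtain ⟨k, hkr, hk⟩ := Finset.exists_lt_of_sum_lt hNpos
        have hk' : ν k ≠ 0 := by exact_mod_cast (ne_of_gt hk)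
        have hkk := hν k hk'
        have hbk : b < k := by omega
        exact ⟨k, hkr, mul_lt_mul_of_pos_left (slt hbk hkk.2) (by exact_mod_cast Nat.pos_of_ne_zero hk')⟩
    rw [E0] at hL
    linarith
  by_cases hbN : b = n
  · -- arc = suffix: `ν` lives on `k < a`; symmetric comparison
    subst hbN
    have ha1 : 1 ≤ a := Nat.one_le_iff_ne_zero.mpr ha0
    have hL : (∑ k ∈ range (b + 1), (μ k : ℤ)) * S a ≤ ∑ k ∈ range (b + 1), (μ k : ℤ) * S k := by
      rw [Finset.sum_mul]
      apply Finset.sum_le_sum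
      intro k _
      by_cases hk : μ k = 0
      · simp [hk]
      · exact mul_le_mul_of_nonneg_left (sle (hμ k hk).1 ((hμ k hk).2)) (by positivity)
    have hR' : ∑ k ∈ range (b + 1), (ν k : ℤ) * S k < (∑ k ∈ range (b + 1), (ν k : ℤ)) * S a := by
      rw [Finset.sum_mul]
      apply Finset.sum_lt_sum
      · intro k _
        by_cases hk : ν k = 0
        · simp [hk]
        · have hkk := hν k hk
          have hka : k < a := by omega
          exact mul_le_mul_of_nonneg_left (sle hka.le (by omega)) (by positivity)
      · have hNpos : ∑ k ∈ range (b + 1), (0 : ℤ) < ∑ k ∈ range (b + 1), (ν k : ℤ) := by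
          rw [← E0]; simpa using hMpos
        obtain ⟨k, hkr, hk⟩ := Finset.exists_lt_of_sum_lt hNpos
        have hk' : ν k ≠ 0 := by exact_mod_cast (ne_of_gt hk)
        have hkk := hν k hk'
        have hka : k < a := by omega
        exact ⟨k, hkr, mul_lt_mul_of_pos_left (slt hka (by omega)) (by exact_mod_cast Nat.pos_of_ne_zero hk')⟩
    rw [← E0] at hR'
    linarith
  -- interior arc: use the chord through the neighbours `a - 1` and `b + 1`
  have ha1 : 1 ≤ a := Nat.one_le_iff_ne_zero.mpr ha0
  have hb1 : b + 1 ≤ n := by omega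
  set A := S (a - 1) with hA
  set B := S (b + 1) with hB
  set α := V (a - 1) with hα
  set β := V (b + 1) with hβ
  -- the chord functional `Φ k = (B − A)(V k − α) − (β − α)(S k − A)`
  set Φ : ℕ → ℤ := fun k => (B - A) * V k + (-(β - α)) * S k + (-(B - A) * α + (β - α) * A) with hΦ
  have hΦin : ∀ k, a ≤ k → k ≤ b → Φ k < 0 := by
    intro k hak hkb
    have := chain_below_chord d v ε θ p hdom hθ hne (i := a - 1) (j := k) (k := b + 1) (by omega) (by omega) hb1
    simp only [hΦ, hA, hB, hα, hβ, hS, hV]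
    nlinarith
  have hΦlo : ∀ k, k < a - 1 → Φ k > 0 := by
    intro k hk
    have := chain_below_chord d v ε θ p hdom hθ hne (i := k) (j := a - 1) (k := b + 1) hk (by omega) hb1
    simp only [hΦ, hA, hB, hα, hβ, hS, hV]
    nlinarith
  have hΦhi : ∀ k, b + 1 < k → k ≤ n → Φ k > 0 := by
    intro k hk hkn
    have := chain_below_chord d v ε θ p hdom hθ hne (i := a - 1) (j := b + 1) (k := k) (by omega) hk hkn
    simp only [hΦ, hA, hB, hα, hβ, hS, hV]
    nlinarith
  have hΦa : Φ (a - 1) = 0 := by simp only [hΦ, hA, hα]; ring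
  have hΦb : Φ (b + 1) = 0 := by simp only [hΦ, hB, hβ]; ring
  -- both weighted `Φ`-sums coincide …
  have hsum : ∑ k ∈ range (n + 1), (μ k : ℤ) * Φ k = ∑ k ∈ range (n + 1), (ν k : ℤ) * Φ k := by
    simp only [hΦ]
    rw [sum_affine, sum_affine, E1, E2, E0]
  -- … but the `μ`-sum is negative and the `ν`-sum is non-negative
  have hneg : ∑ k ∈ range (n + 1), (μ k : ℤ) * Φ k < 0 := by
    have h0 : ∑ k ∈ range (n + 1), (0 : ℤ) = 0 := by simp
    rw [← h0]
    apply Finset.sum_lt_sum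
    · intro k _
      by_cases hk : μ k = 0
      · simp [hk]
      · have hkk := hμ k hk
        have := hΦin k hkk.1 hkk.2
        have : (0 : ℤ) < μ k := by exact_mod_cast Nat.pos_of_ne_zero hk
        nlinarith
    · refine ⟨k₀, hk₀r, ?_⟩
      have := hΦin k₀ hk₀ab.1 hk₀ab.2
      have : (0 : ℤ) < μ k₀ := by exact_mod_cast Nat.pos_of_ne_zero hk₀
      nlinarith
  have hnonneg : 0 ≤ ∑ k ∈ range (n + 1), (ν k : ℤ) * Φ k := by
    apply Finset.sum_nonneg
    intro k _
    by_cases hk : ν k = 0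
    · simp [hk]
    · have hkk := hν k hk
      have hνpos : (0 : ℤ) ≤ ν k := by positivity
      rcases hkk.1 with hka | hkb
      · rcases Nat.lt_or_ge k (a - 1) with h | h
        · exact mul_nonneg hνpos (hΦlo k h).le
        · have : k = a - 1 := by omega
          rw [this, hΦa, mul_zero]
      · rcases Nat.lt_or_ge (b + 1) k with h | h
        · exact mul_nonneg hνpos (hΦhi k h hkk.2).le
        · have : k = b + 1 := by omega
          rw [this, hΦb, mul_zero]
  rw [hsum] at hneg
  exact absurd hneg (not_lt.mpr hnonneg)

/-- **A dominant term is never an average of the rest of the chain** (the one-point arc): the incidence multiset of a single term of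
the chain, scaled by a positive integer `N`, is never a conic combination with total weight `N` of the incidence multisets of the other
terms of the chain — a chain term is not a rational convex combination of the others. [folklore] -/
theorem not_conic_of_others (hdom : ∀ k ≤ n, IsDominant d v ε (θ k) (p k)) (hθ : ∀ k < n, θ k < θ (k + 1))
    (hne : ∀ k < n, p k ≠ p (k + 1)) {a : ℕ} (han : a ≤ n) (N : ℕ) (hN : N ≠ 0) (ν : ℕ → ℕ)
    (hν : ∀ k, ν k ≠ 0 → k ≠ a ∧ k ≤ n) (hMN : N = ∑ k ∈ range (n + 1), ν k)
    (hrel : N • inc (p a) = ∑ k ∈ range (n + 1), ν k • inc (p k)) : False := by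
  classical
  have har : a ∈ range (n + 1) := mem_range.mpr (by omega)
  refine arc_law d v ε θ p hdom hθ hne (le_refl a) han (fun k => if k = a then N else 0) ν ?_ ?_ ⟨a, by simp [hN]⟩ ?_ ?_
  · intro k hk
    by_cases h : k = a
    · subst h; exact ⟨le_rfl, le_rfl⟩
    · simp [h] at hk
  · intro k hk
    have := hν k hk
    exact ⟨by omega, this.2⟩
  · rw [Finset.sum_ite_eq' (range (n + 1)) a, if_pos har]
    exact hMN
  · rw [← hrel]
    rw [show (∑ k ∈ range (n + 1), (if k = a then N else 0) • inc (p k)) =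
        ∑ k ∈ range (n + 1), (if k = a then N • inc (p k) else 0) from
      Finset.sum_congr rfl fun k _ => by split_ifs with h <;> simp [h]]
    rw [Finset.sum_ite_eq' (range (n + 1)) a, if_pos har]

end Arc

end ConvexPosition

end Summit.ValiantsHypothesis.ValiantsHypothesis.Theorems.KPlusLogSqLaw
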